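/-
Copyright (c) 2026 the pub-hodgecm-mathlib formalisation cell (harness21).  Prover seat hodgecm-mathlib-LH10-p01 (g11): road M6 → F3 → F5 (LEAD F0P3a-plan T15-32 «GO-LOW»),
brick (B2c-II) «THE 2-FREE ROW-0 CLASS VALUES AT A FRAME» for the (B3) F5 head of LH7-p04 (g12); 2026-09-03.
-/
import Literature.NumberTheory.Rogawski1990.DepthZeroKappaTransferTypeTwoRowZeroPlaceCount       -- ★ (B2c-I): `ncard_rankStrata_zero_eq_ncard_isSelfDualLattice_stable_level_of_frame`
import Literature.NumberTheory.Rogawski1990.DepthZeroKappaTransferTypeTwoClassTotalsAtFrame       -- ★ (B2b-II) p853378: `exists_ne_zero_and_valuation_sq_mul_eq_one_iff_even_log` (§1 parity)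
import Literature.NumberTheory.Automorphic.EndoscopicPairShift                                     -- ★ ED.2 p853277: `UnitaryLatticeTree.cast_ncard_vertex_rowZero_eq_of_total`, `shift_pairLetters`
import Literature.NumberTheory.Rogawski1990.SelfDualStableLatticeCountInertPlace                  -- ★ F5-(0) p853304 (LH4-p01): `ncard_isSelfDualLattice_stable_eq_phiTHn_inertPlace ∕ _phiTHprimen_inertPlace`
import Literature.NumberTheory.Rogawski1990.EndoscopicBlockFrameAlgHom                             -- ★ (O-5)-place: `exists_algHom_blockFrame_apply_eq_of_conj_place`
import Literature.NumberTheory.Rogawski1990.UnitOrbitalIntegralInertValueTHOfKappa                 -- ★ B-p12: the κ-reading kit (`exists_toLocalRing_eq_formValue`, `finKappaAt_eq_ite_even_of_nonsplit_of_isUnramifiedIn`, `sum_map_mulVec_mul_mulVec_eq_of_formCongr_eq`, `conjLocal_apply_eq_galAdicCompletionMap`)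
import Literature.NumberTheory.Rogawski1990.FinExplicitTransferFactorKappaOddEigenline             -- ★ B-p14: `twistGram_apply_self_eq_formValue` (+ `mulVec_col_eq_smul_of_blockFrame`, `blockFrame_apply_corner`, `twistGram_blockFrame_eq`, `blockFrame_gram_hermitian`)
import Literature.NumberTheory.Automorphic.UnitaryGroupIwasawaFiniteAdelic                          -- ★ `isUnit_placeForm_antidiagonal_unit_mem_glInt`, `placeForm_antidiagonal`
import Literature.NumberTheory.Weil1982.UnitaryLocalRingBaseField                                   -- ★ `exists_complexConj_eq_neg_ne_zero`
import HarnessLib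

/-!
# The 2-free ROW-0 class values of a depth-zero type-(2) match at an integral frame of the inert place (★ (B2c-I) ∘ ★ (W1) ED. 2 ∘ ★ F5-(0), the class token discharged)

Topic `NumberTheory/Rogawski1990`; namespace `Literature.NumberTheory.Rogawski1990`.  THEOREMS ONLY (no definition, no instance, no notation, no named fact, no `sorry`);
kernel lane `--supports stmt-HodgeConjecture-24833`.  Cell `pub/hodgecm-mathlib` (D-0151), crux H413 = `stmt-HodgeConjecture-24833`; road M6 → F3 → F5 «2-free type-(2) G-side head»
(LEAD F0P3a-plan T15-32 «GO-LOW»), brick **(B2c-II) «ROW-0 CLASS VALUES AT A FRAME»** feeding the (B3) F5 head of LH7-p04 (g12) (its placeholders `h0p ∕ h0m`); the ROW-0 twin of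
★ (B2b-II) p853378 (same binders + `hn2 hN1`).  HONEST LABEL: HC_CM is proved only modulo the 7 printed citations (2 remaining named inputs: hLiu418 = stmt-HodgeConjecture-24832,
h413 = stmt-HodgeConjecture-24833) until rung 0 closes; count-neutral assembly of ★ bricks (pays no organ; zero label movement until F5 ★ and a desk-priced rider).

THE MATHEMATICS.  ★ (B2c-I) reads the residually-trivial stratum as `n₀(δ) = #{M J₀-self-dual, (Tδ_wT⁻¹)M ⊆ M, (Tδ_wT⁻¹ − 1)M ⊆ ϖM}`; `Tδ_wT⁻¹ = φ_b(g_w, u_w)` (★ (O-5)-place);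
★ (W1) ED. 2 `cast_ncard_vertex_rowZero_eq_of_total` turns this LEVEL-ONE count into the TOTAL count of the SHIFTED pair `(ϖ⁻¹(g_w − 1), ϖ⁻¹(u_w − 1))`, of Eisenstein exponents
`(n − 2, N − 1)`, provided the total count is known as a function `G` of the exponents on all pairs carrying ★ F5-(0)'s pair letters (`C`) and the shifted pair carries them
(★ `shift_pairLetters`); ★ F5-(0) supplies `G = phiTHn q` on CLASS I ∕ `phiTHprimen q` on CLASS II, the class token at `c_fr e₃` being pair-independent and read from
`κ_v(γ_H, δ)` exactly as in ★ (B2b-II) (`c e₃` eigenvector ★ B-p14, value `ι_w x₀` ★ B-p12, ★ `finKappaAt_eq_ite_even_of_nonsplit_of_isUnramifiedIn`, §1 parity of ★ (B2b-II)).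
[cite: Rogawski1990, §4.9 Lemma 4.9.3 p. 56, Prop. 4.9.1 (b) p. 55; §4.8 Case (a) p. 53] [cite: Kottwitz1986BaseChangeUnits, §1 pp. 240–241] [cite: Flicker1998UnitaryFL, Prop. 11 p. 87, Props. 16–17 pp. 96–97, Theorem 18 p. 97]

* **`ncard_rankStrata_zero_eq_phiTHn_of_frame_of_finKappaAt_eq_one`** (class I), **`ncard_rankStrata_zero_eq_phiTHprimen_of_frame_of_finKappaAt_eq_neg_one`** (class II).

## References
* [Rogawski1990] J. D. Rogawski, *Automorphic Representations of Unitary Groups in Three Variables*, Ann. of Math. Stud. 123 (1990): §4.9 Lemma 4.9.3 p. 56, Prop. 4.9.1 (b) p. 55; §4.8 p. 53.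
* [Kottwitz1986BaseChangeUnits] R. E. Kottwitz, *Base change for unit elements of Hecke algebras*, Compositio Math. 60 (1986): §1 pp. 240–241.
* [Flicker1998UnitaryFL] Y. Z. Flicker, *Elementary proof of the fundamental lemma for a unitary group*, Canad. J. Math. 50 (1998): Prop. 11 p. 87, Props. 16–17, Theorem 18 p. 97.
-/

set_option autoImplicit false

noncomputable section

open NumberField IsDedekindDomain Matrix Polynomial ValuativeRel
open scoped MatrixGroups WithZero ValuativeRel

namespace Literature.NumberTheory.Rogawski1990

open Literature.NumberTheory.Automorphic Literature.NumberTheory.Automorphic.UnitaryGroup Literature.NumberTheory.Automorphic.IntegralReduction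
open Literature.NumberTheory.Automorphic.UnitaryLatticeTree Literature.NumberTheory.Automorphic.HermitianLattice Literature.NumberTheory.GaloisRepresentations Literature.NumberTheory.NumberFields
open Literature.NumberTheory.Rogawski1990.Flicker1998 (phiTHn phiTHprimen)

variable (L : Type) [Field L] [NumberField L] [IsCMField L] (H' : Matrix (Fin 3) (Fin 3) L)
  {v : HeightOneSpectrum (𝓞 ↥(maximalRealSubfield L))}

section Frame

variable {L H'}
  (hH' : (H'.map (IsCMField.complexConj L))ᵀ = H') (w : PlacesOver L v)
  (hw : IsCMField.complexConj L • w.1 = w.1) (hv : Algebra.IsUnramifiedIn (𝓞 L) v.asIdeal) (hH'u : IsUnit H')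
  {γH : (cmDatum L 2 (Matrix.of fun i j : Fin 2 => if i.val + j.val + 1 = 2 then (1 : L) else 0)).Local v ×
    (cmDatum L 1 (Matrix.of fun i j : Fin 1 => if i.val + j.val + 1 = 1 then (1 : L) else 0)).Local v}
  (hreg : IsLocalGRegular L v γH)
  (hirr : ¬ ∃ x : w.1.adicCompletion L, (((γH.1.val : GL (Fin 2) (LocalRing L v)).val.map
      (Pi.evalRingHom (fun w' : PlacesOver L v => w'.1.adicCompletion L) w)).charpoly).IsRoot x)
  (δ : (cmDatum L 3 H').Local v) (h : IsLocalNormPair L H' v γH δ)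
  (ht : ∀ m : ℕ, ValuativeRel.valuation (w.1.adicCompletion L)
    (((((δ.val : GL (Fin 3) (LocalRing L v)).val.map (Pi.evalRingHom (fun w' : UnitaryGroup.PlacesOver L v => w'.1.adicCompletion L) w))).charpoly -
      (Polynomial.X - 1) ^ 3).coeff m) < 1)
  {cj : GL (Fin 3) (LocalRing L v)}
  (hcj : cj * ((endoEmbLocal L v γH).val : GL (Fin 3) (LocalRing L v)) * cj⁻¹ = (δ.val : GL (Fin 3) (LocalRing L v)))
  (T : GL (Fin 3) (w.1.adicCompletion L)) (hTint : T ∈ glInt 3 (w.1.adicCompletion L))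
  (hJT : placeForm H' w.1 = formCongr (galAdicCompletionMap (L := L) (IsCMField.complexConj L) hw) T ((StdForm.antidiagonal 3).over (w.1.adicCompletion L)))
  -- ★ F5-(0)'s θ-package of the row (`F := L⁺`, `E := L`, `c := complexConj`)
  {M : Type} [Field M] [NumberField M] [Algebra L M] (w₁ : PlacesOver M w.1)
  {aF k₀ : v.adicCompletion ↥(maximalRealSubfield L)} (haF : Valued.v aF < 1) (hk₀ : Valued.v k₀ = WithZero.exp (-1 : ℤ))
  {θ : w₁.1.adicCompletion M} (s' : w₁.1.adicCompletion M →+* w₁.1.adicCompletion M)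
  (hθ : θ ^ 2 = toPlace w.1 w₁ (toPlace v w aF) * θ + toPlace w.1 w₁ (toPlace v w k₀)) (hθv : Valued.v θ = WithZero.exp (-1 : ℤ))
  (hcoord : ∀ z : w₁.1.adicCompletion M, ∃! pq : w.1.adicCompletion L × w.1.adicCompletion L, z = toPlace w.1 w₁ pq.1 + toPlace w.1 w₁ pq.2 * θ)
  (hint : ∀ p q : w.1.adicCompletion L, toPlace w.1 w₁ p + toPlace w.1 w₁ q * θ ∈ 𝒪[w₁.1.adicCompletion M] ↔ p ∈ 𝒪[w.1.adicCompletion L] ∧ q ∈ 𝒪[w.1.adicCompletion L])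
  (hs'ι : ∀ x, s' (toPlace w.1 w₁ x) = toPlace w.1 w₁ (galAdicCompletionMap (L := L) (IsCMField.complexConj L) hw x)) (hs'θ : s' θ = θ) (hs's' : ∀ z, s' (s' z) = z)
  (hs'O : ∀ z : 𝒪[w₁.1.adicCompletion M], s' z ∈ 𝒪[w₁.1.adicCompletion M]) (hs'v : ∀ z, Valued.v (s' z) = Valued.v z)
  (hnorm1 : ∀ c₁ : w₁.1.adicCompletion M, c₁ ≠ 0 → s' c₁ = c₁ → Even (WithZero.log (Valued.v c₁)) → ∃ a : w₁.1.adicCompletion M, a * s' a * c₁ = 1)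
  -- the block frame `c_fr = T · c_w` and its algebra map (★ `exists_algHom_blockFrame`)
  (cfr : GL (Fin 3) (w.1.adicCompletion L))
  (hcfr : (cfr : Matrix (Fin 3) (Fin 3) (w.1.adicCompletion L)) = (T : Matrix (Fin 3) (Fin 3) (w.1.adicCompletion L)) *
    ((cj : GL (Fin 3) (LocalRing L v)) : Matrix (Fin 3) (Fin 3) (LocalRing L v)).map (Pi.evalRingHom (fun w' : PlacesOver L v => w'.1.adicCompletion L) w))
  (φb : (Matrix (Fin 2) (Fin 2) (w.1.adicCompletion L) × w.1.adicCompletion L) →ₐ[w.1.adicCompletion L] Matrix (Fin 3) (Fin 3) (w.1.adicCompletion L))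
  (hφb : ∀ (g : Matrix (Fin 2) (Fin 2) (w.1.adicCompletion L)) (u : w.1.adicCompletion L),
    φb (g, u) = (cfr : Matrix (Fin 3) (Fin 3) (w.1.adicCompletion L)) *
      Matrix.reindex endoPerm endoPerm (Matrix.fromBlocks g 0 0 (u • (1 : Matrix (Fin 1) (Fin 1) (w.1.adicCompletion L)))) *
      ((cfr⁻¹ : GL (Fin 3) (w.1.adicCompletion L)) : Matrix (Fin 3) (Fin 3) (w.1.adicCompletion L)))
  (φ : (w.1.adicCompletion L × w₁.1.adicCompletion M) →ₐ[w.1.adicCompletion L] Matrix (Fin 3) (Fin 3) (w.1.adicCompletion L)) (hφ : Function.Injective φ)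
  (hstar : ∀ b : w.1.adicCompletion L × w₁.1.adicCompletion M, (StdForm.antidiagonal 3).over (w.1.adicCompletion L) *
    φ (RingHom.prodMap (galAdicCompletionMap (L := L) (IsCMField.complexConj L) hw) s' b) =
      ((φ b).map (galAdicCompletionMap (L := L) (IsCMField.complexConj L) hw))ᵀ * (StdForm.antidiagonal 3).over (w.1.adicCompletion L))
  -- the Eisenstein block of the (B3) head (★ F2 `exists_eisensteinData` ∕ ★ (W1)'s letters, `ϖ`-currency)
  {ϖ : w.1.adicCompletion L} (hϖ : Valued.v ϖ = WithZero.exp (-1 : ℤ))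
  {Θ : Matrix (Fin 2) (Fin 2) (w.1.adicCompletion L)} {α β a b : w.1.adicCompletion L}
  (hΘ : Θ = α • (1 : Matrix (Fin 2) (Fin 2) (w.1.adicCompletion L)) +
    β • ((γH.1.val : GL (Fin 2) (LocalRing L v)).val.map (Pi.evalRingHom (fun w' : PlacesOver L v => w'.1.adicCompletion L) w)))
  (hΘd : Valued.v Θ.det = Valued.v ϖ) (hΘt : Valued.v Θ.trace < 1)
  (hrel : finGammaTwo L v γH w • (1 : Matrix (Fin 2) (Fin 2) (w.1.adicCompletion L)) -
      (γH.1.val : GL (Fin 2) (LocalRing L v)).val.map (Pi.evalRingHom (fun w' : PlacesOver L v => w'.1.adicCompletion L) w) =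
    a • (1 : Matrix (Fin 2) (Fin 2) (w.1.adicCompletion L)) + b • Θ)
  (n N : ℕ) (hn : Valued.v (((finCharpolyTwo L v γH).eval (finGammaTwo L v γH)) w) = WithZero.exp (-(n : ℤ)))
  (hb : Valued.v b = Valued.v ϖ ^ N)
  (hg1 : ∀ i j, Valued.v ((((γH.1.val : GL (Fin 2) (LocalRing L v)).val.map (Pi.evalRingHom (fun w' : PlacesOver L v => w'.1.adicCompletion L) w)) - 1) i j) ≤
    WithZero.exp (-1 : ℤ))
  (hu1 : Valued.v (finGammaTwo L v γH w - 1) ≤ WithZero.exp (-1 : ℤ))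
  -- ★ F5-(0)'s pair letters: a root `λ ∈ M_{w₁}` of `χ_{g_w}`, `φ(u_w, λ) = φ_b(g_w, u_w)`, the Krylov unit, generation, coordinates, the ⋆-polynomial
  {lam : w₁.1.adicCompletion M}
  (hlam : lam ^ 2 - toPlace w.1 w₁ ((γH.1.val : GL (Fin 2) (LocalRing L v)).val.map (Pi.evalRingHom (fun w' : PlacesOver L v => w'.1.adicCompletion L) w)).trace * lam +
    toPlace w.1 w₁ ((γH.1.val : GL (Fin 2) (LocalRing L v)).val.map (Pi.evalRingHom (fun w' : PlacesOver L v => w'.1.adicCompletion L) w)).det = 0)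
  (hφx : φ ((finGammaTwo L v γH w, lam) : w.1.adicCompletion L × w₁.1.adicCompletion M) =
    φb (((γH.1.val : GL (Fin 2) (LocalRing L v)).val.map (Pi.evalRingHom (fun w' : PlacesOver L v => w'.1.adicCompletion L) w)), finGammaTwo L v γH w))
  (hK : IsUnit (Matrix.of fun i j : Fin 3 =>
    (((φb (((γH.1.val : GL (Fin 2) (LocalRing L v)).val.map (Pi.evalRingHom (fun w' : PlacesOver L v => w'.1.adicCompletion L) w)), finGammaTwo L v γH w)) ^ (j : ℕ)) *ᵥ
      ((cfr : Matrix (Fin 3) (Fin 3) (w.1.adicCompletion L)) *ᵥ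
        (Pi.single (endoPerm (Sum.inl 0)) (1 : w.1.adicCompletion L) + Pi.single (endoPerm (Sum.inr 0)) (1 : w.1.adicCompletion L)))) i).det)
  (hall : ∀ x : w.1.adicCompletion L × w₁.1.adicCompletion M, ∃ Q : (w.1.adicCompletion L)[X],
    aeval ((finGammaTwo L v γH w, lam) : w.1.adicCompletion L × w₁.1.adicCompletion M) Q = x)
  (hcoordlam : ∀ z : w₁.1.adicCompletion M, ∃ p q : w.1.adicCompletion L, z = toPlace w.1 w₁ p + toPlace w.1 w₁ q * lam)
  (P : (w.1.adicCompletion L)[X]) (hP : ∀ i, P.coeff i ∈ 𝒪[w.1.adicCompletion L])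
  (hPx : aeval ((finGammaTwo L v γH w, lam) : w.1.adicCompletion L × w₁.1.adicCompletion M) P =
    (galAdicCompletionMap (L := L) (IsCMField.complexConj L) hw (finGammaTwo L v γH w), s' lam))
  (hgateV : ∀ (u' p' q' t' D' : w.1.adicCompletion L) (N'' b' : ℕ),
    ((u', toPlace w.1 w₁ p' + toPlace w.1 w₁ q' * θ) : w.1.adicCompletion L × w₁.1.adicCompletion M) *
      RingHom.prodMap (galAdicCompletionMap (L := L) (IsCMField.complexConj L) hw) s'
        ((u', toPlace w.1 w₁ p' + toPlace w.1 w₁ q' * θ) : w.1.adicCompletion L × w₁.1.adicCompletion M) = 1 →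
    Valued.v (u' - 1) < 1 → Valued.v (p' - 1) < 1 → Valued.v q' = WithZero.exp (-(N'' : ℤ)) →
    (toPlace w.1 w₁ p' + toPlace w.1 w₁ q' * θ) ^ 2 - toPlace w.1 w₁ t' * (toPlace w.1 w₁ p' + toPlace w.1 w₁ q' * θ) + toPlace w.1 w₁ D' = 0 →
    Valued.v (u' * u' - t' * u' + D') = WithZero.exp (-(b' : ℤ)) →
    ((∃ x : Fin 3 → w.1.adicCompletion L, ∃ g₁ ∈ unitaryGroupOfForm (galAdicCompletionMap (L := L) (IsCMField.complexConj L) hw)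
        ((StdForm.antidiagonal 3).over (w.1.adicCompletion L)),
      Submodule.span 𝒪[w.1.adicCompletion L] (Set.range fun k : Fin 3 =>
        ((φ ((u', toPlace w.1 w₁ p' + toPlace w.1 w₁ q' * θ) : w.1.adicCompletion L × w₁.1.adicCompletion M)) ^ (k : ℕ)) *ᵥ x) =
        Submodule.span 𝒪[w.1.adicCompletion L] (Set.range ((g₁ : Matrix (Fin 3) (Fin 3) (w.1.adicCompletion L)))ᵀ)) ↔
    Even (WithZero.log (Valued.v (∑ k, ∑ i,
      galAdicCompletionMap (L := L) (IsCMField.complexConj L) hw (((cfr : Matrix (Fin 3) (Fin 3) (w.1.adicCompletion L)) *ᵥ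
        Pi.single (endoPerm (Sum.inr 0)) (1 : w.1.adicCompletion L)) i) *
      (StdForm.antidiagonal 3).over (w.1.adicCompletion L) i k *
      ((cfr : Matrix (Fin 3) (Fin 3) (w.1.adicCompletion L)) *ᵥ Pi.single (endoPerm (Sum.inr 0)) (1 : w.1.adicCompletion L)) k)) + b')))

set_option synthInstance.maxHeartbeats 200000 in
set_option maxHeartbeats 1600000 in
-- the strata sets, the lattice sets and ★ F5-(0)'s ≈ 50-binder instantiation are large terms (★ `…UnitRow` ∕ ★ GSide budgets)
include hH' hv hH'u hirr h ht hcj hTint hJT haF hk₀ hθ hθv hcoord hint hs'ι hs'θ hs's' hs'O hs'v hnorm1 hcfr hφb hφ hstar hϖ hΘ hΘd hΘt hrel hn hb hg1 hu1 hlam hφx hall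
  hcoordlam hP hPx hgateV in
open scoped Classical in
/-- **THE KEY STEP (both classes)**: row 0 is ★ ED. 2's level count at `J₀`, `c_fr`, evaluated by ★ F5-(0) at the shifted exponents; the class-I token holds iff `κ_v(γ_H, δ) = 1`.
[cite: Rogawski1990, §4.9 Lemma 4.9.3 p. 56, Prop. 4.9.1 (b) p. 55] [cite: Flicker1998UnitaryFL, Prop. 11 p. 87, Props. 16–17 pp. 96–97] -/
private theorem ncard_rankStrata_zero_eq_and_token_iff (hn2 : 2 ≤ n) (hN1 : 1 ≤ N) :
    (({q : (cmDatum L 3 H').Local v ⧸ cmLocalIntegralLevel L 3 H' v |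
            q ∈ MulAction.fixedBy ((cmDatum L 3 H').Local v ⧸ cmLocalIntegralLevel L 3 H' v) δ ∧
              (redMat ((((q.out⁻¹ * δ * q.out : (cmDatum L 3 H').Local v)).val : GL (Fin 3) (LocalRing L v)).val.map
                (Pi.evalRingHom (fun w' : UnitaryGroup.PlacesOver L v => w'.1.adicCompletion L) w)) - 1).rank = 0}.ncard : ℕ) : ℚ) =
      (if finKappaAt L v H' γH δ = 1 then phiTHn (Nat.card 𝓀[v.adicCompletion ↥(maximalRealSubfield L)]) (n - 2) (N - 1)
        else phiTHprimen (Nat.card 𝓀[v.adicCompletion ↥(maximalRealSubfield L)]) (n - 2) (N - 1)) := by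
  classical
  have hc1 : IsCMField.complexConj L ≠ 1 := IsCMField.complexConj_ne_one L
  haveI : Algebra.IsQuadraticExtension ↥(maximalRealSubfield L) L := IsCMField.isQuadraticExtension L
  set σ : w.1.adicCompletion L →+* w.1.adicCompletion L := galAdicCompletionMap (L := L) (IsCMField.complexConj L) hw with hσdef
  set ev := Pi.evalRingHom (fun w' : PlacesOver L v => w'.1.adicCompletion L) w with hev
  have hσσ : ∀ x, σ (σ x) = x := galAdicCompletionMap_galAdicCompletionMap_of_smul_eq (IsCMField.complexConj L) w hc1 hw
  have hvσ : ∀ x, Valued.v (σ x) = Valued.v x := fun x => valued_galAdicCompletionMap (L := L) (IsCMField.complexConj L) hw x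
  have hιv : ∀ y : v.adicCompletion ↥(maximalRealSubfield L), Valued.v (toPlace v w y) = Valued.v y :=
    fun y => Literature.NumberTheory.Automorphic.Liu2021.LemD1IndexedNonVacuityInertCofinite.valued_toPlace_of_isUnramifiedIn L v hv w y
  have hϖk : Valued.v (toPlace v w k₀) = WithZero.exp (-1 : ℤ) := by rw [hιv, hk₀]
  have hϖ0 : toPlace v w k₀ ≠ 0 := fun h0 => by rw [h0, map_zero] at hϖk; exact WithZero.coe_ne_zero hϖk.symm
  have hϖ1 : Valued.v (toPlace v w k₀) ≤ 1 := by rw [hϖk, ← WithZero.exp_zero]; exact WithZero.exp_le_exp.2 (by norm_num)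
  -- ### (1) ★ (B2c-I) at `ϖ := ι_w k₀`: row 0 is the LEVEL-ONE `J₀`-lattice count at `T δ_w T⁻¹`
  have hrow := ncard_rankStrata_zero_eq_ncard_isSelfDualLattice_stable_level_of_frame L H' w hw hv δ ht T hTint hJT hϖk
  -- ### (2) the form `J₀` as a unit: integral, hermitian, `L₀` self-dual, transitivity (2-free)
  have hΦw : IsUnit (placeForm ((StdForm.antidiagonal 3).over L) w.1) := by
    rw [placeForm_antidiagonal]; exact (StdForm.antidiagonal 3).isUnit_over _
  have hJ : hΦw.unit ∈ glInt 3 (w.1.adicCompletion L) := isUnit_placeForm_antidiagonal_unit_mem_glInt (E := L) (N := 3) w.1 hΦw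
  have hJ0m : ((hΦw.unit : GL (Fin 3) (w.1.adicCompletion L)) : Matrix (Fin 3) (Fin 3) (w.1.adicCompletion L)) =
      (StdForm.antidiagonal 3).over (w.1.adicCompletion L) := by rw [IsUnit.unit_spec, placeForm_antidiagonal]
  have hJh : (((hΦw.unit : GL (Fin 3) (w.1.adicCompletion L)) : Matrix (Fin 3) (Fin 3) (w.1.adicCompletion L)).map σ)ᵀ = hΦw.unit := by
    rw [hJ0m, StdForm.over_map, StdForm.transpose_over]
  have hL₀ : IsSelfDualLattice σ (toPlace v w k₀) ((hΦw.unit : GL (Fin 3) (w.1.adicCompletion L)) : Matrix (Fin 3) (Fin 3) (w.1.adicCompletion L))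
      (stdLattice (w.1.adicCompletion L) 3) := by
    rw [hJ0m]; exact isSelfDualLattice_stdLattice_three_of_v hϖk
  have htrace : ∃ t : w.1.adicCompletion L, Valued.v t ≤ 1 ∧ t + σ t = 1 := by
    let σO := (galAdicCompletionMap (L := L) (IsCMField.complexConj L) hw).restrict (ValuativeRel.valuation (w.1.adicCompletion L)).integer _
      fun x hx => galAdicCompletionMap_mem_integer (IsCMField.complexConj L) w hw hx
    obtain ⟨t, ht1⟩ := exists_add_map_eq_one_integer (IsCMField.complexConj L) w hc1 hw hv σO (fun _ => rfl) fun x => Subtype.ext (hσσ x)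
    exact ⟨t, (v_le_one_iff_mem_integer (t : w.1.adicCompletion L)).2 t.2, congrArg Subtype.val ht1⟩
  have htrans : ∀ Λ : Submodule (Valued.integer (w.1.adicCompletion L)) (Fin 3 → w.1.adicCompletion L),
      IsSelfDualLattice σ (toPlace v w k₀) ((hΦw.unit : GL (Fin 3) (w.1.adicCompletion L)) : Matrix (Fin 3) (Fin 3) (w.1.adicCompletion L)) Λ →
        ∃ g₁ : ↥(unitaryGroupOfForm σ ((hΦw.unit : GL (Fin 3) (w.1.adicCompletion L)) : Matrix (Fin 3) (Fin 3) (w.1.adicCompletion L))),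
          Λ = mapGL ((g₁ : ↥(unitaryGroupOfForm σ ((hΦw.unit : GL (Fin 3) (w.1.adicCompletion L)) : Matrix (Fin 3) (Fin 3) (w.1.adicCompletion L)))) :
            GL (Fin 3) (w.1.adicCompletion L)) (stdLattice (w.1.adicCompletion L) 3) := by
    rw [hJ0m]
    intro Λ hΛ
    obtain ⟨g₁, hg₁⟩ := exists_unitary_mapGL_stdLattice_eq_of_isSelfDualLattice_of_trace hσσ hvσ hϖk htrace hΛ
    exact ⟨g₁, hg₁.symm⟩
  -- ### (3) the block frame: `φ_b(g_w, u_w) = T δ_w T⁻¹` (★ (O-5)-place at `c`, then conjugation by `T`)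
  set cw : GL (Fin 3) (w.1.adicCompletion L) := Units.map (RingHom.mapMatrix ev).toMonoidHom cj with hcw
  have hcwval : (cw : Matrix (Fin 3) (Fin 3) (w.1.adicCompletion L)) = ((cj : GL (Fin 3) (LocalRing L v)) : Matrix (Fin 3) (Fin 3) (LocalRing L v)).map ev := rfl
  have hcfr' : cfr = T * cw := Units.ext (by rw [Units.val_mul, hcwval, hcfr])
  obtain ⟨φ₀, hφ₀, hφ₀w⟩ := exists_algHom_blockFrame_apply_eq_of_conj_place L H' w γH hcj
  have hframe : φb (((γH.1.val : GL (Fin 2) (LocalRing L v)).val.map ev), finGammaTwo L v γH w) =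
      (T : Matrix (Fin 3) (Fin 3) (w.1.adicCompletion L)) *
        ((δ.val : GL (Fin 3) (LocalRing L v)) : Matrix (Fin 3) (Fin 3) (LocalRing L v)).map ev *
        ((T⁻¹ : GL (Fin 3) (w.1.adicCompletion L)) : Matrix (Fin 3) (Fin 3) (w.1.adicCompletion L)) := by
    have e1 := hφ₀ (((γH.1.val : GL (Fin 2) (LocalRing L v)).val.map ev)) (finGammaTwo L v γH w)
    rw [hφ₀w] at e1
    rw [hφb, hcfr', _root_.mul_inv_rev, Units.val_mul, Units.val_mul, e1]
    simp only [Matrix.mul_assoc]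
    rfl
  -- ### (4) the eigenvector `p′ = c e₃` of `δ`, its `H′_v`-value `x₀ ∈ L⁺_v`, `x₀ ≠ 0`, and the κ-reading
  obtain ⟨δ₁, hcδ, hδ₁⟩ := Literature.NumberTheory.Weil1982.UnitaryFinTopForm.exists_complexConj_eq_neg_ne_zero L
  have hF := Liu2021.LemD1IndexedNonVacuityNonsplitPlace.isField_localRing_of_nonsplit L v (IsCMField.complexConj L) hcδ hδ₁ w hw
  letI : Field (UnitaryGroup.LocalRing L v) := hF.toField
  have hA : Irreducible ((γH.1.val : GL (Fin 2) (UnitaryGroup.LocalRing L v)).val.charpoly) :=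
    irreducible_charpoly_of_not_exists_isRoot_eval L v w hw _ hirr
  have hA' : ∀ r : UnitaryGroup.LocalRing L v, (γH.1.val : GL (Fin 2) (UnitaryGroup.LocalRing L v)).val.charpoly.eval r ≠ 0 :=
    Literature.LinearAlgebra.Matrix.eval_charpoly_ne_zero_of_irreducible hA (by simp)
  have hu : IsUnit ((finCharpolyTwo L v γH).eval (finGammaTwo L v γH)) := by
    obtain ⟨y, hy⟩ := hF.mul_inv_cancel (hA' (finGammaTwo L v γH))
    exact IsUnit.of_mul_eq_one _ hy
  have hH'c : (H'.map (cmConjRingHom L))ᵀ = H' := by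
    have e1 : H'.map (cmConjRingHom L) = H'.map (IsCMField.complexConj L) := by
      ext i j; simp [Matrix.map_apply, cmConjRingHom_apply]
    rw [e1]; exact hH'
  have hσσv : ∀ s, UnitaryGroup.conjLocal L (IsCMField.complexConj L) v (UnitaryGroup.conjLocal L (IsCMField.complexConj L) v s) = s :=
    Liu2021.LemD1OfPlace.conjLocal_conjLocal_apply L v (IsCMField.complexConj L) hcδ hδ₁
  have hH := UnitaryGroup.map_conjLocal_transpose_localForm L 3 H' v hH'c
  have hHd := UnitaryGroup.isUnit_det_localForm L 3 H' v (Matrix.isUnit_iff_isUnit_det _ |>.1 hH'u).ne_zero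
  have hfr := mul_eq_mul_reindex_fromBlocks_of_conj_endoEmbLocal_eq L H' γH hcj
  set p' : Fin 3 → UnitaryGroup.LocalRing L v := fun i => cj.val i (endoPerm (Sum.inr 0)) with hp'def
  have hp' : (δ.val.val : Matrix (Fin 3) (Fin 3) (UnitaryGroup.LocalRing L v)) *ᵥ p' = finGammaTwo L v γH • p' :=
    mulVec_col_eq_smul_of_blockFrame endoPerm hfr
  have hne : p' ≠ 0 := by
    intro h0
    apply (Matrix.isUnits_det_units cj).ne_zero
    exact Matrix.det_eq_zero_of_column_eq_zero (endoPerm (Sum.inr 0)) fun i => congrFun h0 i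
  obtain ⟨x₀, hx₀⟩ := exists_toLocalRing_eq_formValue L v H' hH'c p'
  have hval0 : (∑ i : Fin 3, ∑ k : Fin 3, UnitaryGroup.conjLocal L (IsCMField.complexConj L) v (p' i) *
      ((UnitaryGroup.adelicForm L 3 H').map (UnitaryGroup.adeleToLocal L v)) i k * p' k) ≠ 0 := by
    obtain ⟨G₁, g₃, hTw, -, -⟩ := twistGram_blockFrame_eq (UnitaryGroup.conjLocal L (IsCMField.complexConj L) v) endoPerm _ hσσv δ.2 hfr hA'
    obtain ⟨-, -, -, hg₃0⟩ := blockFrame_gram_hermitian (UnitaryGroup.conjLocal L (IsCMField.complexConj L) v) endoPerm _ hσσv hH hHd.ne_zero hTw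
    rw [← twistGram_apply_self_eq_formValue, hTw, blockFrame_apply_corner]
    exact hg₃0
  have hx₀0 : x₀ ≠ 0 := fun h0 => hval0 (by rw [← hx₀, h0, map_zero])
  have hvx₀0 : Valued.v x₀ ≠ 0 := (Valuation.ne_zero_iff _).2 hx₀0
  have hite := finKappaAt_eq_ite_even_of_nonsplit_of_isUnramifiedIn L v H' γH δ w hw hv h hu hp' hne x₀ hx₀0 hx₀
  -- ### (5) the token vector `c_fr e₃ = T (c e₃)_w` and its `J₀`-value `ι_w x₀`
  set pw : Fin 3 → w.1.adicCompletion L := fun i => p' i w with hpw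
  have hcol : (cfr : Matrix (Fin 3) (Fin 3) (w.1.adicCompletion L)) *ᵥ Pi.single (endoPerm (Sum.inr 0)) (1 : w.1.adicCompletion L) =
      (T : Matrix (Fin 3) (Fin 3) (w.1.adicCompletion L)) *ᵥ pw := by
    rw [Matrix.mulVec_single_one, hcfr]
    ext i
    simp only [Matrix.col_apply, Matrix.mul_apply, Matrix.mulVec, dotProduct, Matrix.map_apply, hpw, hp'def]
    rfl
  have hvalue : dotProduct (fun i => σ (((cfr : Matrix (Fin 3) (Fin 3) (w.1.adicCompletion L)) *ᵥ Pi.single (endoPerm (Sum.inr 0)) (1 : w.1.adicCompletion L)) i))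
      ((StdForm.antidiagonal 3).over (w.1.adicCompletion L) *ᵥ ((cfr : Matrix (Fin 3) (Fin 3) (w.1.adicCompletion L)) *ᵥ
        Pi.single (endoPerm (Sum.inr 0)) (1 : w.1.adicCompletion L))) = toPlace v w x₀ := by
    have key : ∀ (A : Matrix (Fin 3) (Fin 3) (w.1.adicCompletion L)) (q : Fin 3 → w.1.adicCompletion L),
        dotProduct (fun i => σ (q i)) (A *ᵥ q) = ∑ i, ∑ k, σ (q i) * A i k * q k := by
      intro A q
      simp only [dotProduct, Matrix.mulVec, Finset.mul_sum, mul_assoc]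
    rw [key, hcol, sum_map_mulVec_mul_mulVec_eq_of_formCongr_eq σ T hJT.symm pw]
    have e2 := congrFun hx₀ w
    rw [UnitaryGroup.toLocalRing_apply] at e2
    rw [e2]
    simp only [Finset.sum_apply, Pi.mul_apply, hpw]
    refine Finset.sum_congr rfl fun i _ => Finset.sum_congr rfl fun k _ => ?_
    rw [conjLocal_apply_eq_galAdicCompletionMap L v w hw, UnitaryGroup.adelicForm_map_adeleToLocal, Matrix.map_apply]
    rfl
  -- the token in ★ F5-(0)'s `ValuativeRel` currency ⟺ `|z|²|x₀| = 1` ⟺ (§1) `ord_v x₀` even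
  have htoken : ∀ z : w.1.adicCompletion L, valuation (w.1.adicCompletion L) (σ z * z * toPlace v w x₀) = 1 ↔ Valued.v z ^ 2 * Valued.v x₀ = 1 := fun z => by
    rw [← v_eq_one_iff_valuation_eq_one, map_mul, map_mul, hvσ, hιv, sq]
  have hpar := exists_ne_zero_and_valuation_sq_mul_eq_one_iff_even_log hϖ hvx₀0
  -- ### (6) the Eisenstein letters in ★ F5-(0)'s `ι_w k₀`-currency; integrality of `g_w`, `u_w`
  have hΘd' : Valued.v Θ.det = Valued.v (toPlace v w k₀) := by rw [hΘd, hϖ, hϖk]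
  have hb' : Valued.v b = Valued.v (toPlace v w k₀) ^ N := by rw [hb, hϖ, hϖk]
  have hn' : Valued.v (finGammaTwo L v γH w • (1 : Matrix (Fin 2) (Fin 2) (w.1.adicCompletion L)) -
      (γH.1.val : GL (Fin 2) (LocalRing L v)).val.map ev).det = Valued.v (toPlace v w k₀) ^ n := by
    have e1 : (finGammaTwo L v γH w • (1 : Matrix (Fin 2) (Fin 2) (w.1.adicCompletion L)) - (γH.1.val : GL (Fin 2) (LocalRing L v)).val.map ev).det =
        ((finCharpolyTwo L v γH).eval (finGammaTwo L v γH)) w := by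
      rw [eval_finCharpolyTwo_finGammaTwo, Matrix.det_fin_two]
      simp only [hev, Pi.evalRingHom_apply, Pi.add_apply, Pi.sub_apply, Pi.mul_apply, Matrix.trace_fin_two, Matrix.det_fin_two, Matrix.sub_apply,
        Matrix.smul_apply, Matrix.map_apply, Matrix.one_apply_eq, Matrix.one_apply_ne (by decide : (0 : Fin 2) ≠ 1),
        Matrix.one_apply_ne (by decide : (1 : Fin 2) ≠ 0), smul_eq_mul, mul_one, mul_zero]
      ring
    rw [e1, hn, hϖk, ← WithZero.exp_nsmul]
    simp
  -- ### (7) ★ `shift_pairLetters`: ★ F5-(0)'s pair letters at the SHIFTED pair (`g₁₀ ≠ 0`, `χ_g(u) ≠ 0` from the Eisenstein data, ★ (c5-i))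
  obtain ⟨-, -, hirr', h10⟩ := charpoly_ne_zero_of_eisensteinData hϖk hΘ hΘd' hΘt
  have hσO : ∀ x : 𝒪[w.1.adicCompletion L], σ x ∈ 𝒪[w.1.adicCompletion L] := fun x => mem_integer_galAdicCompletionMap (IsCMField.complexConj L) v w hw x
  have hϖO : toPlace v w k₀ ∈ 𝒪[w.1.adicCompletion L] := (v_le_one_iff_mem_integer _).1 hϖ1
  have hσϖ : σ (toPlace v w k₀) = toPlace v w k₀ := galAdicCompletionMap_toPlace (IsCMField.complexConj L) w w hw k₀
  have hg1' : ∀ i j, Valued.v ((((γH.1.val : GL (Fin 2) (LocalRing L v)).val.map ev) - 1) i j) ≤ Valued.v (toPlace v w k₀) := fun i j => by rw [hϖk]; exact hg1 i j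
  have hu1' : Valued.v (finGammaTwo L v γH w - 1) ≤ Valued.v (toPlace v w k₀) := by rw [hϖk]; exact hu1
  obtain ⟨hgS, huS, -, hlamS, hφxS, hKS, hallS, hcoordS, P', hP', hPx'⟩ := shift_pairLetters σ s' hs'ι hσO hϖ0 hϖO hσϖ cfr φb hφb φ hg1' hu1' h10
    (hirr' (finGammaTwo L v γH w)) hlam hφx hall hcoordlam hP hPx
  -- the side condition `C` = ★ F5-(0)'s pair letters, and the shifted pair carries it
  set C : Matrix (Fin 2) (Fin 2) (w.1.adicCompletion L) → w.1.adicCompletion L → Prop := fun g u =>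
    (∀ i j, g i j ∈ 𝒪[w.1.adicCompletion L]) ∧ u ∈ 𝒪[w.1.adicCompletion L] ∧ ∃ lam' : w₁.1.adicCompletion M,
      lam' ^ 2 - toPlace w.1 w₁ g.trace * lam' + toPlace w.1 w₁ g.det = 0 ∧ φ ((u, lam') : w.1.adicCompletion L × w₁.1.adicCompletion M) = φb (g, u) ∧
      IsUnit (Matrix.of fun i j : Fin 3 => (((φb (g, u)) ^ (j : ℕ)) *ᵥ ((cfr : Matrix (Fin 3) (Fin 3) (w.1.adicCompletion L)) *ᵥ
        (Pi.single (endoPerm (Sum.inl 0)) (1 : w.1.adicCompletion L) + Pi.single (endoPerm (Sum.inr 0)) (1 : w.1.adicCompletion L)))) i).det ∧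
      (∀ x : w.1.adicCompletion L × w₁.1.adicCompletion M, ∃ Q : (w.1.adicCompletion L)[X], aeval ((u, lam') : w.1.adicCompletion L × w₁.1.adicCompletion M) Q = x) ∧
      (∀ z : w₁.1.adicCompletion M, ∃ p q : w.1.adicCompletion L, z = toPlace w.1 w₁ p + toPlace w.1 w₁ q * lam') ∧
      ∃ P'' : (w.1.adicCompletion L)[X], (∀ i, P''.coeff i ∈ 𝒪[w.1.adicCompletion L]) ∧
        aeval ((u, lam') : w.1.adicCompletion L × w₁.1.adicCompletion M) P'' = (σ u, s' lam') with hCdef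
  have hCg' : C ((toPlace v w k₀)⁻¹ • (((γH.1.val : GL (Fin 2) (LocalRing L v)).val.map ev) - 1)) ((toPlace v w k₀)⁻¹ * (finGammaTwo L v γH w - 1)) :=
    ⟨hgS, huS, _, hlamS, hφxS, hKS, hallS, hcoordS, P', hP', hPx'⟩
  -- ### (8) the two classes: ★ ED. 2 over ★ F5-(0) as the total count function
  rw [hrow]
  split_ifs with hκ
  · -- CLASS I: `κ = 1` ⇒ `ord_v x₀` even ⇒ the token holds; `G := phiTHn q`
    have heven : Even (WithZero.log (Valued.v x₀)) := by
      by_contra hodd; rw [hκ, if_neg hodd] at hite; norm_num at hite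
    obtain ⟨z, hz0, hz⟩ := hpar.2 heven
    have hED := cast_ncard_vertex_rowZero_eq_of_total σ hϖ0 hϖ1 ((StdForm.antidiagonal 3).over (w.1.adicCompletion L)) 0 φb C
      (fun n' N' => phiTHn (Nat.card 𝓀[v.adicCompletion ↥(maximalRealSubfield L)]) n' N')
      (fun g' Θ' u' α' β' a' b' n' N' hC hΘ' hΘd'' hΘt' hrel' hn'' hb'' => by
        obtain ⟨hg', hu'', lam', hlam', hφx', hK', hall', hcoordlam', P'', hP'', hPx''⟩ := hC
        have hF5 := ncard_isSelfDualLattice_stable_eq_phiTHn_inertPlace (IsCMField.complexConj L) v hc1 hv w hw w₁ haF hk₀ s' hθ hθv hcoord hint hs'ι hs'θ hs's'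
          hs'O hs'v hnorm1 hΦw.unit hJ hJh hL₀ htrans cfr φb hφb φ hφ (fun b₁ => by rw [hJ0m]; exact hstar b₁) hg' hu'' hΘ' hΘd'' hΘt' hrel' hn'' hb'' hlam' hφx' hK'
          hall' hcoordlam' P'' hP'' hPx'' (by rw [hJ0m]; exact hgateV) ⟨z, hz0, by rw [hJ0m, hvalue]; exact (htoken z).2 hz⟩
        rw [hJ0m] at hF5
        exact hF5)
      hCg' hΘ hΘd' hΘt hrel hn' hb' hn2 hN1
    rw [hframe] at hED
    exact hED
  · -- CLASS II: `κ = −1` ⇒ `ord_v x₀` odd ⇒ the token fails; `G := phiTHprimen q`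
    have hκ' : finKappaAt L v H' γH δ = -1 := (finKappaAt_eq_one_or_eq_neg_one_of_isUnit L v H' γH δ h hu).resolve_left hκ
    have hodd : ¬ Even (WithZero.log (Valued.v x₀)) := by
      intro heven; rw [hκ', if_pos heven] at hite; norm_num at hite
    have hED := cast_ncard_vertex_rowZero_eq_of_total σ hϖ0 hϖ1 ((StdForm.antidiagonal 3).over (w.1.adicCompletion L)) 0 φb C
      (fun n' N' => phiTHprimen (Nat.card 𝓀[v.adicCompletion ↥(maximalRealSubfield L)]) n' N')
      (fun g' Θ' u' α' β' a' b' n' N' hC hΘ' hΘd'' hΘt' hrel' hn'' hb'' => by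
        obtain ⟨hg', hu'', lam', hlam', hφx', hK', hall', hcoordlam', P'', hP'', hPx''⟩ := hC
        have hF5 := ncard_isSelfDualLattice_stable_eq_phiTHprimen_inertPlace (IsCMField.complexConj L) v hc1 hv w hw w₁ haF hk₀ s' hθ hθv hcoord hint hs'ι hs'θ hs's'
          hs'O hs'v hnorm1 hΦw.unit hJ hJh hL₀ htrans cfr φb hφb φ hφ (fun b₁ => by rw [hJ0m]; exact hstar b₁) hg' hu'' hΘ' hΘd'' hΘt' hrel' hn'' hb'' hlam' hφx' hK'
          hall' hcoordlam' P'' hP'' hPx'' (by rw [hJ0m]; exact hgateV)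
          (fun z hz0 hz => hodd (hpar.1 ⟨z, hz0, (htoken z).1 (by rw [hJ0m, hvalue] at hz; exact hz)⟩))
        rw [hJ0m] at hF5
        exact hF5)
      hCg' hΘ hΘd' hΘt hrel hn' hb' hn2 hN1
    rw [hframe] at hED
    exact hED

include hH' hv hH'u hirr h ht hcj hTint hJT haF hk₀ hθ hθv hcoord hint hs'ι hs'θ hs's' hs'O hs'v hnorm1 hcfr hφb hφ hstar hϖ hΘ hΘd hΘt hrel hn hb hg1 hu1 hlam hφx hall
  hcoordlam hP hPx hgateV in
open scoped Classical in
/-- **(B2c-II), CLASS I: `n₀(δ) = Φ_{n−2}(N−1) = phiTHn q (n−2) (N−1)` for a deep type-(2) match with `κ_v(γ_H, δ) = +1`** (`n ≥ 2`, `N ≥ 1`), at an integral frame `T` of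
`H′_w` and the block frame `c_fr = T·c_w`, over the (B3) head's Eisenstein letters and ★ F5-(0)'s row-∕pair-level block (see the module docstring); `q = #𝓀(L⁺_v)`.
[cite: Rogawski1990, §4.9 Lemma 4.9.3 p. 56, Prop. 4.9.1 (b) p. 55] [cite: Kottwitz1986BaseChangeUnits, §1 pp. 240–241] [cite: Flicker1998UnitaryFL, Prop. 11 p. 87; Theorem 18 p. 97] -/
theorem ncard_rankStrata_zero_eq_phiTHn_of_frame_of_finKappaAt_eq_one (hn2 : 2 ≤ n) (hN1 : 1 ≤ N) (hκ : finKappaAt L v H' γH δ = 1) :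
    (({q : (cmDatum L 3 H').Local v ⧸ cmLocalIntegralLevel L 3 H' v |
            q ∈ MulAction.fixedBy ((cmDatum L 3 H').Local v ⧸ cmLocalIntegralLevel L 3 H' v) δ ∧
              (redMat ((((q.out⁻¹ * δ * q.out : (cmDatum L 3 H').Local v)).val : GL (Fin 3) (LocalRing L v)).val.map
                (Pi.evalRingHom (fun w' : UnitaryGroup.PlacesOver L v => w'.1.adicCompletion L) w)) - 1).rank = 0}.ncard : ℕ) : ℚ) =
      phiTHn (Nat.card 𝓀[v.adicCompletion ↥(maximalRealSubfield L)]) (n - 2) (N - 1) := by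
  have key := ncard_rankStrata_zero_eq_and_token_iff hH' w hw hv hH'u hirr δ h ht hcj T hTint hJT w₁ haF hk₀ s' hθ hθv hcoord hint hs'ι hs'θ hs's' hs'O hs'v hnorm1
    cfr hcfr φb hφb φ hφ hstar hϖ hΘ hΘd hΘt hrel n N hn hb hg1 hu1 hlam hφx hall hcoordlam P hP hPx hgateV hn2 hN1
  rwa [if_pos hκ] at key

include hH' hv hH'u hirr h ht hcj hTint hJT haF hk₀ hθ hθv hcoord hint hs'ι hs'θ hs's' hs'O hs'v hnorm1 hcfr hφb hφ hstar hϖ hΘ hΘd hΘt hrel hn hb hg1 hu1 hlam hφx hall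
  hcoordlam hP hPx hgateV in
open scoped Classical in
/-- **(B2c-II), CLASS II: `n₀(δ) = Φ′_{n−2}(N−1) = phiTHprimen q (n−2) (N−1)` for a deep type-(2) match with `κ_v(γ_H, δ) = −1`** (same frame, same letters).
[cite: Rogawski1990, §4.9 Lemma 4.9.3 p. 56, Prop. 4.9.1 (b) p. 55] [cite: Kottwitz1986BaseChangeUnits, §1 pp. 240–241] [cite: Flicker1998UnitaryFL, Props. 16–17 pp. 96–97; Theorem 18 p. 97] -/
theorem ncard_rankStrata_zero_eq_phiTHprimen_of_frame_of_finKappaAt_eq_neg_one (hn2 : 2 ≤ n) (hN1 : 1 ≤ N) (hκ : finKappaAt L v H' γH δ = -1) :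
    (({q : (cmDatum L 3 H').Local v ⧸ cmLocalIntegralLevel L 3 H' v |
            q ∈ MulAction.fixedBy ((cmDatum L 3 H').Local v ⧸ cmLocalIntegralLevel L 3 H' v) δ ∧
              (redMat ((((q.out⁻¹ * δ * q.out : (cmDatum L 3 H').Local v)).val : GL (Fin 3) (LocalRing L v)).val.map
                (Pi.evalRingHom (fun w' : UnitaryGroup.PlacesOver L v => w'.1.adicCompletion L) w)) - 1).rank = 0}.ncard : ℕ) : ℚ) =
      phiTHprimen (Nat.card 𝓀[v.adicCompletion ↥(maximalRealSubfield L)]) (n - 2) (N - 1) := by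
  have key := ncard_rankStrata_zero_eq_and_token_iff hH' w hw hv hH'u hirr δ h ht hcj T hTint hJT w₁ haF hk₀ s' hθ hθv hcoord hint hs'ι hs'θ hs's' hs'O hs'v hnorm1
    cfr hcfr φb hφb φ hφ hstar hϖ hΘ hΘd hΘt hrel n N hn hb hg1 hu1 hlam hφx hall hcoordlam P hP hPx hgateV hn2 hN1
  rwa [if_neg (by rw [hκ]; norm_num)] at key

end Frame

end Literature.NumberTheory.Rogawski1990

end
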